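import Mathlib.Algebra.BigOperators.Ring.Finset
import Mathlib.Algebra.BigOperators.Group.Finset.Sigma
import Mathlib.Algebra.Order.BigOperators.Group.Finset
import Mathlib.Algebra.Order.Ring.Abs
import Mathlib.Data.Real.Basic
import Mathlib.Tactic.Linarith
import Mathlib.Tactic.Ring
import Mathlib.Tactic.NthRewrite
import Literature.Probability.LatticeModels.LatticeGraph

/-!
# The 2×2 cross-ratio contraction algebra of Chelkak–Wan's Lemma 3.7
— UBHP brick B-crossalg of line `symplectic-fermion-anchor`
(crux `SAWLoopFugacityFlow.AvoidanceLimit`, stmt-CriticalPhenomena-10649; lead c3)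

The uniform boundary Harnack principle `stub_uniformBHP` (UBHP) of the line is proved, following
D. Chelkak, Y. Wan, *On the convergence of massive loop-erased random walks to massive SLE(2)
curves*, Electron. J. Probab. 26 (2021), §3.2, by iterating the ONE-ANNULUS CONTRACTION of their
Lemma 3.7. Its algebraic core ("applying this identity four times and rearranging terms") is the
following statement about finite sums of real numbers, with no random walk in it. Put
`F_m(x) := Σ_{i ∈ I} Σ_{j ∈ J} x_i K_{ij} m_j` for entrance weights `x = a, b ≥ 0`, a kernel `K`
across an annulus and boundary values `m = H₁, H₂`. If every 2×2 minor of `K` on `I × J` is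
`k`-contracted, `|K_{ij}K_{i'j'} − K_{ij'}K_{i'j}| ≤ k (K_{ij}K_{i'j'} + K_{ij'}K_{i'j})`, and the
boundary values have cross-oscillation at most `M` on `J`,
`|H₁(j)H₂(j') − H₁(j')H₂(j)| ≤ M (H₁(j)H₂(j') + H₁(j')H₂(j))`, then the cross-oscillation of
`(F_{H₁}, F_{H₂})` between `a` and `b` is at most `k·M`:
`|F_{H₁}(a)F_{H₂}(b) − F_{H₁}(b)F_{H₂}(a)| ≤ k M (F_{H₁}(a)F_{H₂}(b) + F_{H₁}(b)F_{H₂}(a))`.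

* `crossMinor_smear_le` — smearing the kernel against nonnegative entrance weights preserves the
  `k`-contraction of 2×2 minors: with `α_j = Σ_i a_i K_{ij}`, `β_j = Σ_i b_i K_{ij}`,
  `|α_j β_{j'} − α_{j'} β_j| ≤ k (α_j β_{j'} + α_{j'} β_j)` (one column pair `(P, Q)` at a time);
* `crossDiff_le_of_crossMinor_le` — the polarisation step: `k`-contracted minors of the pair
  `(α, β)` and `M`-oscillation of `(H₁, H₂)` give `k·M`-oscillation of
  `((Σ α H₁)(Σ β H₂), (Σ β H₁)(Σ α H₂))` (the two polarisation identities
  `2 (AB' ∓ A'B) = Σ_{j,j'} (α_j β_{j'} ∓ α_{j'} β_j)(H₁(j)H₂(j') ∓ H₁(j')H₂(j))` and the triangle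
  inequality);
* `cross_contraction` (registered signature) — the statement above, on the index type `Site 2`.

Companion of `Literature/Probability/LatticeModels/BoundaryHarnackContraction.lean`
(`crossDiff_contraction`: the same step with the kernel bound in cross-RATIO form
`K(u,x)K(v,y) ≤ C K(v,x)K(u,y)` and `k = (C−1)/(C+1)`); here the bound is taken directly in the
symmetrised `|·−·| ≤ k (·+·)` form, for every `k` (no sign or size condition is needed), and with
entrance weights. Sources: Chelkak–Wan 2021, proof of Lemma 3.7 (bib key `ChelkakWan2021`).
Pure finite-sum algebra (`Finset.sum_mul_sum`, `Finset.sum_comm`, `Finset.abs_sum_le_sum_abs`).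
No definitions.
-/

open scoped BigOperators
open Finset
open Literature.Probability.LatticeModels

namespace Summit.CriticalPhenomena.SAWScalingLimit.Theorems.AvoidanceLimit.Anchor

/-- **Smearing preserves contracted minors.** For two columns `P, Q : ι → ℝ` of a kernel whose
2×2 minors on `I` are `k`-contracted, `|P i Q i' − Q i P i'| ≤ k (P i Q i' + Q i P i')`, and
nonnegative weights `a, b`, the smeared pair `(Σ a P, Σ b Q; Σ a Q, Σ b P)` is `k`-contracted:
`|(Σ aP)(Σ bQ) − (Σ aQ)(Σ bP)| ≤ k ((Σ aP)(Σ bQ) + (Σ aQ)(Σ bP))`. Proof: both sides are double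
sums `Σ_{i,i'} a_i b_{i'} (P_i Q_{i'} ∓ Q_i P_{i'})`; triangle inequality.
[cite: ChelkakWan2021, proof of Lemma 3.7] -/
theorem crossMinor_smear_le {ι : Type*} (I : Finset ι) (a b P Q : ι → ℝ) (k : ℝ)
    (ha : ∀ i, 0 ≤ a i) (hb : ∀ i, 0 ≤ b i)
    (hK : ∀ i ∈ I, ∀ i' ∈ I, |P i * Q i' - Q i * P i'| ≤ k * (P i * Q i' + Q i * P i')) :
    |(∑ i ∈ I, a i * P i) * (∑ i ∈ I, b i * Q i) - (∑ i ∈ I, a i * Q i) * (∑ i ∈ I, b i * P i)| ≤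
      k * ((∑ i ∈ I, a i * P i) * (∑ i ∈ I, b i * Q i) +
        (∑ i ∈ I, a i * Q i) * (∑ i ∈ I, b i * P i)) := by
  -- the two products as double sums over `I × I`
  have hA : (∑ i ∈ I, a i * P i) * (∑ i ∈ I, b i * Q i) =
      ∑ i ∈ I, ∑ i' ∈ I, a i * b i' * (P i * Q i') := by
    rw [Finset.sum_mul_sum]
    refine Finset.sum_congr rfl fun i _ => Finset.sum_congr rfl fun i' _ => ?_
    ring
  have hB : (∑ i ∈ I, a i * Q i) * (∑ i ∈ I, b i * P i) =
      ∑ i ∈ I, ∑ i' ∈ I, a i * b i' * (Q i * P i') := by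
    rw [Finset.sum_mul_sum]
    refine Finset.sum_congr rfl fun i _ => Finset.sum_congr rfl fun i' _ => ?_
    ring
  -- difference and sum as double sums
  have hdiff : (∑ i ∈ I, a i * P i) * (∑ i ∈ I, b i * Q i) -
      (∑ i ∈ I, a i * Q i) * (∑ i ∈ I, b i * P i) =
      ∑ i ∈ I, ∑ i' ∈ I, a i * b i' * (P i * Q i' - Q i * P i') := by
    rw [hA, hB, ← Finset.sum_sub_distrib]
    refine Finset.sum_congr rfl fun i _ => ?_
    rw [← Finset.sum_sub_distrib]
    refine Finset.sum_congr rfl fun i' _ => ?_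
    ring
  have hsum : (∑ i ∈ I, a i * P i) * (∑ i ∈ I, b i * Q i) +
      (∑ i ∈ I, a i * Q i) * (∑ i ∈ I, b i * P i) =
      ∑ i ∈ I, ∑ i' ∈ I, a i * b i' * (P i * Q i' + Q i * P i') := by
    rw [hA, hB, ← Finset.sum_add_distrib]
    refine Finset.sum_congr rfl fun i _ => ?_
    rw [← Finset.sum_add_distrib]
    refine Finset.sum_congr rfl fun i' _ => ?_
    ring
  -- triangle inequality and the termwise bound
  rw [hdiff, hsum, Finset.mul_sum]
  refine (Finset.abs_sum_le_sum_abs _ _).trans (Finset.sum_le_sum fun i hi => ?_)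
  rw [Finset.mul_sum]
  refine (Finset.abs_sum_le_sum_abs _ _).trans (Finset.sum_le_sum fun i' hi' => ?_)
  have hab : 0 ≤ a i * b i' := mul_nonneg (ha i) (hb i')
  rw [abs_mul, abs_of_nonneg hab]
  calc a i * b i' * |P i * Q i' - Q i * P i'|
      ≤ a i * b i' * (k * (P i * Q i' + Q i * P i')) :=
        mul_le_mul_of_nonneg_left (hK i hi i' hi') hab
    _ = k * (a i * b i' * (P i * Q i' + Q i * P i')) := by ring

/-- **The polarisation step of Chelkak–Wan's Lemma 3.7.** If the pair `(α, β)` has `k`-contracted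
2×2 minors on `T`, `|α_x β_y − α_y β_x| ≤ k (α_x β_y + α_y β_x)`, and `(H₁, H₂)` has
cross-oscillation at most `M` on `T`, `|H₁(x)H₂(y) − H₁(y)H₂(x)| ≤ M (H₁(x)H₂(y) + H₁(y)H₂(x))`,
then, with `A₁ = Σ α H₁`, `A₂ = Σ α H₂`, `B₁ = Σ β H₁`, `B₂ = Σ β H₂` (sums over `T`),
`|A₁ B₂ − B₁ A₂| ≤ k M (A₁ B₂ + B₁ A₂)`. Proof as printed: the polarisation identities
`2 (A₁ B₂ ∓ B₁ A₂) = Σ_{x,y ∈ T} (α_x β_y ∓ α_y β_x)(H₁(x)H₂(y) ∓ H₁(y)H₂(x))` (expand the four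
products into double sums and symmetrise in `(x, y)` with `Finset.sum_comm`), then the triangle
inequality termwise. No sign conditions are needed.
[cite: ChelkakWan2021, proof of Lemma 3.7] -/
theorem crossDiff_le_of_crossMinor_le {κ : Type*} (T : Finset κ) (α β H₁ H₂ : κ → ℝ) (k M : ℝ)
    (hcross : ∀ x ∈ T, ∀ y ∈ T, |α x * β y - α y * β x| ≤ k * (α x * β y + α y * β x))
    (hout : ∀ x ∈ T, ∀ y ∈ T,
      |H₁ x * H₂ y - H₁ y * H₂ x| ≤ M * (H₁ x * H₂ y + H₁ y * H₂ x)) :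
    |(∑ x ∈ T, α x * H₁ x) * (∑ x ∈ T, β x * H₂ x) -
        (∑ x ∈ T, β x * H₁ x) * (∑ x ∈ T, α x * H₂ x)| ≤
      k * M * ((∑ x ∈ T, α x * H₁ x) * (∑ x ∈ T, β x * H₂ x) +
        (∑ x ∈ T, β x * H₁ x) * (∑ x ∈ T, α x * H₂ x)) := by
  -- the two products as double sums over `T × T`
  have hA : (∑ x ∈ T, α x * H₁ x) * (∑ x ∈ T, β x * H₂ x) =
      ∑ x ∈ T, ∑ y ∈ T, α x * β y * (H₁ x * H₂ y) := by
    rw [Finset.sum_mul_sum]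
    refine Finset.sum_congr rfl fun x _ => Finset.sum_congr rfl fun y _ => ?_
    ring
  have hB : (∑ x ∈ T, β x * H₁ x) * (∑ x ∈ T, α x * H₂ x) =
      ∑ x ∈ T, ∑ y ∈ T, α y * β x * (H₁ x * H₂ y) := by
    rw [Finset.sum_mul_sum]
    refine Finset.sum_congr rfl fun x _ => Finset.sum_congr rfl fun y _ => ?_
    ring
  -- the same two products with the roles of `x` and `y` exchanged
  have hA' : (∑ x ∈ T, α x * H₁ x) * (∑ x ∈ T, β x * H₂ x) =
      ∑ x ∈ T, ∑ y ∈ T, α y * β x * (H₁ y * H₂ x) := by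
    rw [hA, Finset.sum_comm]
  have hB' : (∑ x ∈ T, β x * H₁ x) * (∑ x ∈ T, α x * H₂ x) =
      ∑ x ∈ T, ∑ y ∈ T, α x * β y * (H₁ y * H₂ x) := by
    rw [hB, Finset.sum_comm]
  -- polarisation identity for twice the difference
  have hdiff : 2 * ((∑ x ∈ T, α x * H₁ x) * (∑ x ∈ T, β x * H₂ x) -
      (∑ x ∈ T, β x * H₁ x) * (∑ x ∈ T, α x * H₂ x)) =
      ∑ x ∈ T, ∑ y ∈ T, (α x * β y - α y * β x) * (H₁ x * H₂ y - H₁ y * H₂ x) := by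
    rw [two_mul]
    nth_rewrite 1 [hA, hB]
    rw [hA', hB', ← Finset.sum_sub_distrib, ← Finset.sum_sub_distrib, ← Finset.sum_add_distrib]
    refine Finset.sum_congr rfl fun x _ => ?_
    rw [← Finset.sum_sub_distrib, ← Finset.sum_sub_distrib, ← Finset.sum_add_distrib]
    refine Finset.sum_congr rfl fun y _ => ?_
    ring
  -- polarisation identity for twice the sum
  have hsum : 2 * ((∑ x ∈ T, α x * H₁ x) * (∑ x ∈ T, β x * H₂ x) +
      (∑ x ∈ T, β x * H₁ x) * (∑ x ∈ T, α x * H₂ x)) =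
      ∑ x ∈ T, ∑ y ∈ T, (α x * β y + α y * β x) * (H₁ x * H₂ y + H₁ y * H₂ x) := by
    rw [two_mul]
    nth_rewrite 1 [hA, hB]
    rw [hA', hB', ← Finset.sum_add_distrib, ← Finset.sum_add_distrib, ← Finset.sum_add_distrib]
    refine Finset.sum_congr rfl fun x _ => ?_
    rw [← Finset.sum_add_distrib, ← Finset.sum_add_distrib, ← Finset.sum_add_distrib]
    refine Finset.sum_congr rfl fun y _ => ?_
    ring
  -- termwise bound
  have hterm : ∀ x ∈ T, ∀ y ∈ T,
      |(α x * β y - α y * β x) * (H₁ x * H₂ y - H₁ y * H₂ x)| ≤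
        k * M * ((α x * β y + α y * β x) * (H₁ x * H₂ y + H₁ y * H₂ x)) := by
    intro x hx y hy
    have h1 := hcross x hx y hy
    have h2 := hout x hx y hy
    rw [abs_mul]
    calc |α x * β y - α y * β x| * |H₁ x * H₂ y - H₁ y * H₂ x|
        ≤ k * (α x * β y + α y * β x) * (M * (H₁ x * H₂ y + H₁ y * H₂ x)) :=
          mul_le_mul h1 h2 (abs_nonneg _) ((abs_nonneg _).trans h1)
      _ = k * M * ((α x * β y + α y * β x) * (H₁ x * H₂ y + H₁ y * H₂ x)) := by ring
  -- assemble: triangle inequality on the double sum, then divide by two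
  have h2 : |2 * ((∑ x ∈ T, α x * H₁ x) * (∑ x ∈ T, β x * H₂ x) -
      (∑ x ∈ T, β x * H₁ x) * (∑ x ∈ T, α x * H₂ x))| ≤
      k * M * (2 * ((∑ x ∈ T, α x * H₁ x) * (∑ x ∈ T, β x * H₂ x) +
        (∑ x ∈ T, β x * H₁ x) * (∑ x ∈ T, α x * H₂ x))) := by
    rw [hdiff, hsum, Finset.mul_sum]
    refine (Finset.abs_sum_le_sum_abs _ _).trans (Finset.sum_le_sum fun x hx => ?_)
    rw [Finset.mul_sum]
    exact (Finset.abs_sum_le_sum_abs _ _).trans (Finset.sum_le_sum fun y hy => hterm x hx y hy)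
  rw [abs_mul, abs_two] at h2
  linarith

/-- **Chelkak–Wan's one-annulus contraction, algebraic core (Lemma 3.7).** With
`F_m(x) = Σ_{i ∈ I} Σ_{j ∈ J} x_i K_{ij} m_j`: if the 2×2 minors of `K` on `I × J` are
`k`-contracted and `(H₁, H₂)` has cross-oscillation at most `M` on `J`, then for nonnegative
entrance weights `a, b`,
`|F_{H₁}(a)F_{H₂}(b) − F_{H₁}(b)F_{H₂}(a)| ≤ k M (F_{H₁}(a)F_{H₂}(b) + F_{H₁}(b)F_{H₂}(a))`.
Proof: Fubini (`F_m(x) = Σ_j (Σ_i x_i K_{ij}) m_j`), `crossMinor_smear_le` for the smeared pair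
`(Σ_i a_i K_{i·}, Σ_i b_i K_{i·})`, then `crossDiff_le_of_crossMinor_le`. (The hypotheses
`0 ≤ k`, `0 ≤ M`, `K ≥ 0`, `H₁, H₂ ≥ 0` of the registered signature are not used.)
[cite: ChelkakWan2021, Lemma 3.7 (proof, §3.2)] -/
theorem cross_contraction :
    ∀ (I J : Finset (Site 2)) (a b : Site 2 → ℝ) (K : Site 2 → Site 2 → ℝ) (H₁ H₂ : Site 2 → ℝ)
      (k M : ℝ), 0 ≤ k → 0 ≤ M → (∀ i, 0 ≤ a i) → (∀ i, 0 ≤ b i) → (∀ i j, 0 ≤ K i j) →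
      (∀ j, 0 ≤ H₁ j) → (∀ j, 0 ≤ H₂ j) →
      (∀ i ∈ I, ∀ i' ∈ I, ∀ j ∈ J, ∀ j' ∈ J,
        |K i j * K i' j' - K i j' * K i' j| ≤ k * (K i j * K i' j' + K i j' * K i' j)) →
      (∀ j ∈ J, ∀ j' ∈ J, |H₁ j * H₂ j' - H₁ j' * H₂ j| ≤ M * (H₁ j * H₂ j' + H₁ j' * H₂ j)) →
      |(∑ i ∈ I, ∑ j ∈ J, a i * K i j * H₁ j) * (∑ i ∈ I, ∑ j ∈ J, b i * K i j * H₂ j) -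
          (∑ i ∈ I, ∑ j ∈ J, b i * K i j * H₁ j) * (∑ i ∈ I, ∑ j ∈ J, a i * K i j * H₂ j)| ≤
        k * M * ((∑ i ∈ I, ∑ j ∈ J, a i * K i j * H₁ j) * (∑ i ∈ I, ∑ j ∈ J, b i * K i j * H₂ j) +
          (∑ i ∈ I, ∑ j ∈ J, b i * K i j * H₁ j) * (∑ i ∈ I, ∑ j ∈ J, a i * K i j * H₂ j)) := by
  intro I J a b K H₁ H₂ k M _ _ ha hb _ _ _ hKk hHM
  -- Fubini: smear the kernel against the entrance weights first
  have e : ∀ (x H : Site 2 → ℝ), ∑ i ∈ I, ∑ j ∈ J, x i * K i j * H j =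
      ∑ j ∈ J, (∑ i ∈ I, x i * K i j) * H j := by
    intro x H
    rw [Finset.sum_comm]
    refine Finset.sum_congr rfl fun j _ => ?_
    rw [Finset.sum_mul]
  -- the smeared pair has `k`-contracted minors on `J`
  have hcross : ∀ j ∈ J, ∀ j' ∈ J,
      |(∑ i ∈ I, a i * K i j) * (∑ i ∈ I, b i * K i j') -
          (∑ i ∈ I, a i * K i j') * (∑ i ∈ I, b i * K i j)| ≤
        k * ((∑ i ∈ I, a i * K i j) * (∑ i ∈ I, b i * K i j') +
          (∑ i ∈ I, a i * K i j') * (∑ i ∈ I, b i * K i j)) :=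
    fun j hj j' hj' => crossMinor_smear_le I a b (fun i => K i j) (fun i => K i j') k ha hb
      fun i hi i' hi' => hKk i hi i' hi' j hj j' hj'
  rw [e a H₁, e b H₂, e b H₁, e a H₂]
  exact crossDiff_le_of_crossMinor_le J (fun j => ∑ i ∈ I, a i * K i j)
    (fun j => ∑ i ∈ I, b i * K i j) H₁ H₂ k M hcross hHM

end Summit.CriticalPhenomena.SAWScalingLimit.Theorems.AvoidanceLimit.Anchor
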